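import Literature.AlgebraicGeometry.ModuliOfAbelianVarieties.SiegelAdmissibleOfLevelReading      -- ★ P4c `isAdmissibleAt_of_levelReading`
import Literature.AlgebraicGeometry.ModuliOfAbelianVarieties.SiegelAdmissibleOfPairingRead       -- ★ `SiegelAdelicMarking.exists_pairingRead_of_pairingRead` (+ ★ D5 normal form)
import HarnessLib

/-!
# Pairing readings through `r` from a lattice frame of type `δ` (U-e P4b leaf (F10): «pairing readings through `r` from
# Gram `E_δ`», the ★ `exists_isAdmissibleAt_of_normalFormFrame` computation WITHOUT the move)

Topic `AlgebraicGeometry/ModuliOfAbelianVarieties`; namespace `Literature.AlgebraicGeometry.ModuliOfAbelianVarieties`.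
KERNEL ONLY: theorems; no definition, no named fact, no instance, no `sorry`.  Cell hodgecm-mathlib (D-0151), (U)-HEAD node
U-e, socket P4, B-p05 (g13)'s glue plan `Ue_P4b_of` v0.3 (`B-provers/B-p05/PLAN-Ue-P4b-glue-v0.3.B-p05g13.md` 3cd3ec7f, step 10;
hand B-p03 (g13), 2026-08-29T14:20Z).  HC_CM is proved only modulo the 7 printed citations until rung 0 closes; books 0.

[Milne2005ShimuraVarieties] Thm. 6.11 / (63) and [Deligne1971TravauxShimura] 4.12 (b): the level structure of the triple attached
to `[J, a]` is the similitude `η = ū ∘ a`, so the Weil pairing READ THROUGH `a` on torsion points is `χ(a) · ψ_δ`; at an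
integral representative `r ∈ K_δ(1) = GSp_δ(ẑ)` this says: the pairing of `M`-torsion points read at `x̃/M`, `ỹ/M` through `r` is
`ζ_M ^ E_δ(x, y)` for a compatible system of primitive roots `ζ`.  The tree proves the reading through `1` as the `δ`-NORMAL
FORM ★ `AbelianVariety.weilPairingLevel_eq_exp_pow_typeFormMod` (D5: `intGram Φ E = typeForm δ` for `E = c₁([𝒪(Θ)^an])`,
`ζ_M = e(2πi/M)`) and the change of reading `1 ↦ r` as ★ `SiegelAdelicMarking.exists_pairingRead_of_pairingRead`; the U-DAG
producer ★ `exists_isAdmissibleAt_of_normalFormFrame` chains them but then MOVES the marking to a principal representative.  The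
period-map node (P4: «reads admissibility at the SAME `r`») needs the chain WITHOUT the move, in the `hpair` currency of ★ P4c
`isAdmissibleAt_of_levelReading`:

* `SiegelAdelicMarking.pairingRead_one_of_intGram_eq_typeForm` — reading through `1`, for a marking `m` of `A` whose torsion
  parametrisation is a uniformisation `φ : ℝ^{2g}/ℤ^{2g} → A(ℂ)` (chart `Φ`, model `ℂ^g`) read on standard lifts,
  `m.r v = φ [ṽ]`, and an Appell–Humbert datum `p` of `[𝒪(Θ)^an]` in the frame with `intGram Φ p.form = typeForm δ`;
* `SiegelAdelicMarking.exists_pairingRead_of_intGram_eq_typeForm` — reading through ANY `r ∈ K_δ(1)` (`∃ ζ`, primitive and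
  compatible, with the `hpair` clause of ★ P4c VERBATIM);
* `SiegelAdelicMarking.exists_pairingRead_self_of_intGram_eq_typeForm` — the same for the marking's OWN uniformisation
  `(m.Ψ, m.toFun)` with `m.γ = 1` (the (N3) `IsFlatGram` currency of B-typ02 (g11): `p : AHData m.Ψ`,
  `toPic p = picClass (cartierDivisorLineBundle m.isAnalytification Θ)`, `intGram m.Ψ p.form = typeForm δ`);
* `isAdmissibleAt_of_levelReading_of_intGram_eq_typeForm` — composed with ★ P4c: a triple over `Spec ℂ` whose fibre is marked by
  `[J(Z), r]`, `r ∈ K_δ(1)`, with such a frame for an ample `IsLambdaOfAt` witness `Θ` and level sections read through `r`, is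
  admissible at `(Z, r)` — no move.

## References
* [Milne2005ShimuraVarieties] J. S. Milne, *Introduction to Shimura varieties* (2005), §6 Thm. 6.11 pp. 74–75, §12 (63) p. 116.
* [Deligne1971TravauxShimura] P. Deligne, *Travaux de Shimura*, Sém. Bourbaki 389 (1971), 4.12 (b) pp. 148–149, 4.16 p. 150.
* [Lange2023AbelianVarietiesComplex] H. Lange, *Abelian Varieties over the Complex Numbers* (2023), §3.1 (type of a polarisation,
  symplectic basis), §1.5.1 (Gram matrix on the lattice).
-/

set_option autoImplicit false

noncomputable section

open Matrix CategoryTheory AlgebraicGeometry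

namespace Literature.AlgebraicGeometry.ModuliOfAbelianVarieties

open Literature.AlgebraicGeometry.Motives (AbelianVariety AlgPoints CartierDivisor specOver ComplexPoints)
open Literature.AlgebraicGeometry.AbelianSchemes (AbelianSchemeOver PolarizedAbelianSchemeWithLevel)
open Literature.Geometry.Kaehler (ComplexTorus)
open Literature.Geometry.Kaehler.ComplexTorus (AHData proj intGram picClass)
open Literature.NumberTheory.Transcendental (IsAnalytification)
open Literature.AlgebraicGeometry.HodgeTheory (cartierDivisorLineBundle)
open Literature.NumberTheory.Adeles
open Literature.NumberTheory.Automorphic (siegelUpperHalfSpace)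
open SiegelModuli

variable {g : ℕ} {δ : Fin g → ℕ}

namespace SiegelAdelicMarking

variable {J : C0pm δ} {a : gspFinAdelic δ} {A : AbelianVariety ℂ}

/-! ### §1 Reading through `1`: the `δ`-normal form on standard lifts -/

/-- **PAIRING READINGS THROUGH `1` FROM A FRAME OF TYPE `δ`** ([Milne2005ShimuraVarieties] (63); the `δ`-normal form
★ `AbelianVariety.weilPairingLevel_eq_exp_pow_typeFormMod`).  Let `m` mark `A` (by any `[J, a]`), with torsion parametrisation read
on a uniformisation `φ : ℝ^{2g}/ℤ^{2g} → A(ℂ)` (chart `Φ`, model `ℂ^g`, analytification, additive) at standard lifts: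
`m.r v = φ [ṽ]`; let `Θ` be a divisor on `A` and `p` an Appell–Humbert datum of `[𝒪(Θ)^an]` in the chart with
`intGram Φ p.form = typeForm δ` (the lattice basis is symplectic of type `δ` for `c₁(Θ)`).  Then for every level `N ∣ M` the Weil
pairing of `Θ` on `M`-torsion points read at `x̃/M`, `ỹ/M` THROUGH `1` is `e(2πi/M) ^ E_δ(x, y)`.
[cite: Milne2005ShimuraVarieties, §6 Thm. 6.11 pp. 74–75 and §12 (63) p. 116] [cite: Lange2023AbelianVarietiesComplex, §3.1 and §1.5.1] -/
theorem pairingRead_one_of_intGram_eq_typeForm (m : SiegelAdelicMarking J a A) (Θ : CartierDivisor A.X.left) {N : ℕ}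
    {Φ : (Fin g ⊕ Fin g → ℝ) ≃L[ℝ] (Fin g → ℂ)} {φ : ComplexTorus Φ → ComplexPoints A.X}
    (hφ : IsAnalytification (Fin g → ℂ) A.X A.dim φ) (hadd : ∀ x y, φ (x + y) = φ x * φ y)
    (p : AHData Φ) (hp : AHData.toPic p = picClass (cartierDivisorLineBundle hφ Θ)) (hT : intGram Φ p.form = typeForm δ)
    (hr : ∀ v : Fin g ⊕ Fin g → ℚ, m.r v = φ (proj Φ fun i => ((v i : ℚ) : ℝ))) :
    ∀ ⦃M : ℕ⦄, N ∣ M → ∀ (hMΩ : (M : ℂ) ≠ 0) (x y : Fin g ⊕ Fin g → ZMod M) (P Q : A.torsionPoints ℂ (M : ℤ)),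
      (∀ v, AdelicCongr (((1 : gspFinAdelic δ)⁻¹ : gspFinAdelic δ) : GL (Fin g ⊕ Fin g) finAdeleQ) 1 v
          (fun i => ((x i).val : ℚ) / M) → (P : A.Points ℂ) = m.r v) →
      (∀ w, AdelicCongr (((1 : gspFinAdelic δ)⁻¹ : gspFinAdelic δ) : GL (Fin g ⊕ Fin g) finAdeleQ) 1 w
          (fun i => ((y i).val : ℚ) / M) → (Q : A.Points ℂ) = m.r w) →
      haveI := AbelianVariety.isDominant_toSchemeHom_zsmul_of_ne_zero A hMΩ
      A.weilPairingLevel Θ P Q = Complex.exp (2 * Real.pi * Complex.I / M) ^ (AbelianSchemeOver.typeFormMod δ M x y).val := by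
  -- the marked abelian variety has dimension `g`: rewrite `g := A.dim` to meet the D5 lemma's model `ℂ^{dim A}`
  obtain rfl : g = A.dim := m.dim_eq.symm
  intro M _ hMΩ x y P Q hP hQ
  have hM : M ≠ 0 := by rintro rfl; exact hMΩ Nat.cast_zero
  haveI := AbelianVariety.isDominant_toSchemeHom_zsmul_of_ne_zero A hMΩ
  -- reading through `1` is reading at `v = x̃/M` itself
  have hone : ∀ v : Fin A.dim ⊕ Fin A.dim → ℚ,
      AdelicCongr (((1 : gspFinAdelic δ)⁻¹ : gspFinAdelic δ) : GL (Fin A.dim ⊕ Fin A.dim) finAdeleQ) 1 v v := by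
    intro v i
    rw [inv_one, OneMemClass.coe_one, Pi.sub_apply, sub_self]
    exact zero_mem _
  have hvec : ∀ z : Fin A.dim ⊕ Fin A.dim → ZMod M,
      (fun i => ((((fun j => ((z j).val : ℚ) / M) i : ℚ) : ℝ))) = (M : ℝ)⁻¹ • fun i => ((z i).val : ℝ) := by
    intro z
    funext i
    simp only [Pi.smul_apply, smul_eq_mul, Rat.cast_div, Rat.cast_natCast]
    ring
  have hPx := hP _ (hone _)
  have hQy := hQ _ (hone _)
  rw [hr, hvec] at hPx
  rw [hr, hvec] at hQy
  exact AbelianVariety.weilPairingLevel_eq_exp_pow_typeFormMod hφ hadd hM Θ p hp hT x y P Q hPx hQy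

/-! ### §2 Reading through `r ∈ K_δ(1)` (change of reading ★ `exists_pairingRead_of_pairingRead`, no move) -/

/-- **PAIRING READINGS THROUGH `r` FROM A FRAME OF TYPE `δ`** — leaf (F10) of the uniformisation road: in the situation of
`pairingRead_one_of_intGram_eq_typeForm`, for every integral `r ∈ K_δ(1) = GSp_δ(ẑ)` there is a compatible system of primitive roots
of unity `ζ` such that the Weil pairing of `Θ` on `M`-torsion points read at `x̃/M`, `ỹ/M` THROUGH `r` is `ζ_M ^ E_δ(x, y)` for every
`N ∣ M` — the `hpair` hypothesis of ★ P4c `isAdmissibleAt_of_levelReading`, for the SAME `r` (★ `exists_pairingRead_of_pairingRead`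
with `b₁ = 1`, `b₂ = r`; `ζ_M = e(2πi/M) ^ ν̄_M(r)`). [cite: Milne2005ShimuraVarieties, §6 Thm. 6.11 pp. 74–75 and §12 (63) p. 116]
[cite: Deligne1971TravauxShimura, 4.12 (b) pp. 148–149 and 4.16 p. 150] -/
theorem exists_pairingRead_of_intGram_eq_typeForm (hδ : IsPolarizationType δ) (hg : 0 < g) (m : SiegelAdelicMarking J a A)
    (Θ : CartierDivisor A.X.left) {N : ℕ}
    {Φ : (Fin g ⊕ Fin g → ℝ) ≃L[ℝ] (Fin g → ℂ)} {φ : ComplexTorus Φ → ComplexPoints A.X}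
    (hφ : IsAnalytification (Fin g → ℂ) A.X A.dim φ) (hadd : ∀ x y, φ (x + y) = φ x * φ y)
    (p : AHData Φ) (hp : AHData.toPic p = picClass (cartierDivisorLineBundle hφ Θ)) (hT : intGram Φ p.form = typeForm δ)
    (hr : ∀ v : Fin g ⊕ Fin g → ℚ, m.r v = φ (proj Φ fun i => ((v i : ℚ) : ℝ)))
    {r : gspFinAdelic δ} (hr1 : r ∈ principalLevelSubgroup δ 1) :
    ∃ ζ : ℕ → ℂ, (∀ ⦃M : ℕ⦄, N ∣ M → M ≠ 0 → IsPrimitiveRoot (ζ M) M) ∧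
      (∀ ⦃M : ℕ⦄ (k : ℕ), N ∣ M → M ≠ 0 → k ≠ 0 → ζ (k * M) ^ k = ζ M) ∧
      ∀ ⦃M : ℕ⦄, N ∣ M → ∀ (hMΩ : (M : ℂ) ≠ 0) (x y : Fin g ⊕ Fin g → ZMod M) (P Q : A.torsionPoints ℂ (M : ℤ)),
        (∀ v, AdelicCongr ((r⁻¹ : gspFinAdelic δ) : GL (Fin g ⊕ Fin g) finAdeleQ) 1 v
            (fun i => ((x i).val : ℚ) / M) → (P : A.Points ℂ) = m.r v) →
        (∀ w, AdelicCongr ((r⁻¹ : gspFinAdelic δ) : GL (Fin g ⊕ Fin g) finAdeleQ) 1 w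
            (fun i => ((y i).val : ℚ) / M) → (Q : A.Points ℂ) = m.r w) →
        haveI := AbelianVariety.isDominant_toSchemeHom_zsmul_of_ne_zero A hMΩ
        A.weilPairingLevel Θ P Q = ζ M ^ (AbelianSchemeOver.typeFormMod δ M x y).val := by
  -- the roots of unity `e(2πi/M)` of the normal form, primitive and compatible
  set ζ₀ : ℕ → ℂ := fun M => Complex.exp (2 * Real.pi * Complex.I / M) with hζ₀_def
  have hζ₀ : ∀ ⦃M : ℕ⦄, N ∣ M → M ≠ 0 → IsPrimitiveRoot (ζ₀ M) M := fun M _ hM => Complex.isPrimitiveRoot_exp M hM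
  have hζ₀_pow : ∀ ⦃M : ℕ⦄ (k : ℕ), N ∣ M → M ≠ 0 → k ≠ 0 → ζ₀ (k * M) ^ k = ζ₀ M := by
    intro M k _ hM hk
    have hMc : (M : ℂ) ≠ 0 := Nat.cast_ne_zero.2 hM
    have hkc : (k : ℂ) ≠ 0 := Nat.cast_ne_zero.2 hk
    simp only [hζ₀_def]
    rw [← Complex.exp_nat_mul]
    congr 1
    push_cast
    field_simp
  exact m.exists_pairingRead_of_pairingRead hδ hg Θ (one_mem _) hr1 ζ₀ hζ₀ hζ₀_pow
    (m.pairingRead_one_of_intGram_eq_typeForm Θ hφ hadd p hp hT hr)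

/-- `m.r v = m.toFun [ṽ]` for a marking with basis matrix `γ = 1`. [cite: Milne2005ShimuraVarieties, §6 Thm. 6.11 p. 74 and §12 (63) p. 116] -/
theorem r_eq_toFun_proj_of_γ_eq_one (m : SiegelAdelicMarking J a A) (hγ : m.γ = 1) (v : Fin g ⊕ Fin g → ℚ) :
    m.r v = m.toFun (proj m.Ψ fun i => ((v i : ℚ) : ℝ)) := by
  rw [m.r_def, hγ, inv_one, Units.val_one, Matrix.one_mulVec]

/-- **PAIRING READINGS THROUGH `r` FROM A FRAME OF TYPE `δ`, FOR THE MARKING'S OWN UNIFORMISATION** (the (N3) `IsFlatGram`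
currency of the uniformisation road: an Appell–Humbert datum `p : AHData m.Ψ` of `[𝒪(Θ)^an]` read through `m.toFun` with
`intGram m.Ψ p.form = typeForm δ`, the marking having basis matrix `γ = 1` so that `m.r v = m.toFun [ṽ]`): for every
`r ∈ K_δ(1)` the `hpair` clause of ★ P4c holds with some compatible system of primitive roots `ζ`.
[cite: Milne2005ShimuraVarieties, §6 Thm. 6.11 pp. 74–75 and §12 (63) p. 116] [cite: Deligne1971TravauxShimura, 4.12 (b) pp. 148–149] -/
theorem exists_pairingRead_self_of_intGram_eq_typeForm (hδ : IsPolarizationType δ) (hg : 0 < g)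
    (m : SiegelAdelicMarking J a A) (hγ : m.γ = 1) (Θ : CartierDivisor A.X.left) {N : ℕ}
    (p : AHData m.Ψ) (hp : AHData.toPic p = picClass (cartierDivisorLineBundle m.isAnalytification Θ))
    (hT : intGram m.Ψ p.form = typeForm δ) {r : gspFinAdelic δ} (hr1 : r ∈ principalLevelSubgroup δ 1) :
    ∃ ζ : ℕ → ℂ, (∀ ⦃M : ℕ⦄, N ∣ M → M ≠ 0 → IsPrimitiveRoot (ζ M) M) ∧
      (∀ ⦃M : ℕ⦄ (k : ℕ), N ∣ M → M ≠ 0 → k ≠ 0 → ζ (k * M) ^ k = ζ M) ∧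
      ∀ ⦃M : ℕ⦄, N ∣ M → ∀ (hMΩ : (M : ℂ) ≠ 0) (x y : Fin g ⊕ Fin g → ZMod M) (P Q : A.torsionPoints ℂ (M : ℤ)),
        (∀ v, AdelicCongr ((r⁻¹ : gspFinAdelic δ) : GL (Fin g ⊕ Fin g) finAdeleQ) 1 v
            (fun i => ((x i).val : ℚ) / M) → (P : A.Points ℂ) = m.r v) →
        (∀ w, AdelicCongr ((r⁻¹ : gspFinAdelic δ) : GL (Fin g ⊕ Fin g) finAdeleQ) 1 w
            (fun i => ((y i).val : ℚ) / M) → (Q : A.Points ℂ) = m.r w) →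
        haveI := AbelianVariety.isDominant_toSchemeHom_zsmul_of_ne_zero A hMΩ
        A.weilPairingLevel Θ P Q = ζ M ^ (AbelianSchemeOver.typeFormMod δ M x y).val :=
  m.exists_pairingRead_of_intGram_eq_typeForm hδ hg Θ m.isAnalytification m.toFun_add p hp hT
    (m.r_eq_toFun_proj_of_γ_eq_one hγ) hr1

end SiegelAdelicMarking

/-! ### §3 Composed with ★ P4c: admissibility at `(Z, r)` from a frame of type `δ` and level readings through `r` — no move -/

/-- **ADMISSIBILITY AT `(Z, r)` FOR THE GIVEN `r`, FROM A FRAME OF TYPE `δ`** (★ P4c `isAdmissibleAt_of_levelReading` with its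
`hpair` discharged by `SiegelAdelicMarking.exists_pairingRead_of_intGram_eq_typeForm`): a triple `P′` over `Spec ℂ` whose fibre is
marked by `[J(Z), r]`, `r ∈ K_δ(1)`, the marking read on a uniformisation `φ` (chart `Φ`) at standard lifts, carrying an ample `Θ`
with `λ̄ = Λ(𝒪(Θ))` whose class has an Appell–Humbert datum with `intGram Φ p.form = typeForm δ`, and whose level sections are read
through `r` at the classes `eᵢ/N`, is admissible at `(Z, r)` — the SAME `r`, no principal-representative move (contrast ★
`exists_isAdmissibleAt_of_normalFormFrame`). [cite: Milne2005ShimuraVarieties, §6 Thm. 6.11 pp. 74–75 and §12 (63) p. 116]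
[cite: Deligne1971TravauxShimura, 4.12 (b) pp. 148–149 and 4.16 p. 150] [cite: Lange2023AbelianVarietiesComplex, §3.1 and §1.5.1] -/
theorem isAdmissibleAt_of_levelReading_of_intGram_eq_typeForm (hδ : IsPolarizationType δ) (hg : 0 < g) {N : ℕ}
    (P' : PolarizedAbelianSchemeWithLevel g N δ (specOver ℚ ℂ).left)
    (Θ : CartierDivisor (P'.A.fibre (𝟙 (Spec (CommRingCat.of ℂ)))).toAbelianVariety.X.left) (hΘ : Θ.IsAmple)
    (hlam : P'.A.IsLambdaOfAt (𝟙 (Spec (CommRingCat.of ℂ))) P'.D P'.pol.lam Θ)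
    (Z : Matrix (Fin g) (Fin g) ℂ) (hZ : Z ∈ siegelUpperHalfSpace g) {r : gspFinAdelic δ}
    (hr1 : r ∈ principalLevelSubgroup δ 1)
    (m : SiegelAdelicMarking ⟨jOfSiegel δ Z, SiegelComplexRecordSystem.jOfSiegel_mem_C0pm hδ.1 hZ⟩ r
      (P'.A.fibre (𝟙 (Spec (CommRingCat.of ℂ)))).toAbelianVariety)
    {Φ : (Fin g ⊕ Fin g → ℝ) ≃L[ℝ] (Fin g → ℂ)}
    {φ : ComplexTorus Φ → ComplexPoints (P'.A.fibre (𝟙 (Spec (CommRingCat.of ℂ)))).toAbelianVariety.X}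
    (hφ : IsAnalytification (Fin g → ℂ) (P'.A.fibre (𝟙 (Spec (CommRingCat.of ℂ)))).toAbelianVariety.X
      (P'.A.fibre (𝟙 (Spec (CommRingCat.of ℂ)))).toAbelianVariety.dim φ)
    (hadd : ∀ x y, φ (x + y) = φ x * φ y)
    (p : AHData Φ) (hp : AHData.toPic p = picClass (cartierDivisorLineBundle hφ Θ)) (hT : intGram Φ p.form = typeForm δ)
    (hr : ∀ v : Fin g ⊕ Fin g → ℚ, m.r v = φ (proj Φ fun i => ((v i : ℚ) : ℝ)))
    (hlevel : ∀ i : Fin g ⊕ Fin g, ∃ v : Fin g ⊕ Fin g → ℚ,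
      AdelicCongr ((r⁻¹ : gspFinAdelic δ) : GL (Fin g ⊕ Fin g) finAdeleQ) 1 v
          (fun j => (((Pi.single i (1 : ZMod N) : Fin g ⊕ Fin g → ZMod N) j).val : ℚ) / N) ∧
        P'.A.restrictPt (𝟙 (Spec (CommRingCat.of ℂ))) (P'.level.σ i) = m.r v) :
    IsAdmissibleAt hδ r Z hZ P' := by
  obtain ⟨ζ, hζ, hζ_pow, hpair⟩ := m.exists_pairingRead_of_intGram_eq_typeForm hδ hg Θ hφ hadd p hp hT hr hr1
  exact isAdmissibleAt_of_levelReading hδ P' Θ hΘ hlam Z hZ r m ζ hζ hζ_pow hpair hlevel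

end Literature.AlgebraicGeometry.ModuliOfAbelianVarieties

end
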